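import Summits.RiemannHypothesis.RiemannHypothesis.Theorems.SuzukiFlowKernelExplicit
import Summits.RiemannHypothesis.RiemannHypothesis.Theorems.SuzukiThetaFlowDefs

/-!
# The flow kernel `J_θ = ∂_θ K_θ` as an explicit REAL kernel (column DBR; RH-FREE)

RH-FREE throughout; nothing here bears on the truth of RH.  `Theorems.SuzukiFlowKernelExplicit` writes the
flow transform `invFourierLine (L·Θ_θ) 1 x` (`L = −2ξ'/ξ(½ − i·)`) as five complex `x`-side pieces; the flow
kernel of `Theorems.SuzukiThetaFlowDefs` is its real part, `flowKernel θ x = Re invFourierLine (L·Θ_θ) 1 x`.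
Here every piece is identified with a REAL integral / series, giving

* **`flowKernel_eq`** — for `θ > 1` and real `x`,
  `J_θ(x) = −2∫₀^∞ e^{−v/2}K_θ(x−v)dv − 2∫₀^∞ e^{v/2}K_θ(x−v)dv + (log π + γ)K_θ(x)`
  `         − Σ' k (K_θ(x)/(k+1) − 2∫₀^∞ e^{−(2k+½)v}K_θ(x−v)dv) + 2 Σ' n Λ(n) n^{−1/2} K_θ(x − log n)`,
  i.e. `J_θ = k ∗ K_θ` with the causal explicit-formula kernel
  `k = −2(e^{−v/2}+e^{v/2})𝟙_{v>0} + (log π + γ)δ₀ − Σ_k(δ₀/(k+1) − 2e^{−(2k+½)v}𝟙_{v>0}) + 2ΣΛ(n)n^{−1/2}δ_{log n}`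
  — the operator-side input of `FlowPairing` (`𝒥_θ[t] = winOp (flowKernel θ) t`).

References: [Su20] M. Suzuki, ASPM 84 (2020), (1.9); E. Bombieri, Rend. Lincei (9) 11 (2000), Thm 2.
-/

noncomputable section

-- D-0017: `Summit.<S>.<S>.…` is the designed namespace of a single-problem summit.
set_option linter.dupNamespace false

open Complex MeasureTheory Set
open scoped ArithmeticFunction.vonMangoldt

namespace Summit.RiemannHypothesis.RiemannHypothesis.Theorems.SuzukiKernelSemigroup

open Literature.NumberTheory.LFunctions
open Summit.RiemannHypothesis.RiemannHypothesis.Theorems.SuzukiThetaFlow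

/-- RH-FREE.  The causal exponential pieces as real half-line integrals:
`∫ (𝟙_{v>0} e^{av})(v) K_θ(x−v) dv` (complex casts) `= ↑(∫_{v>0} e^{av} K_θ(x−v) dv)`. -/
theorem integral_indicator_exp_mul_limKernel (θ a x : ℝ) :
    ∫ v : ℝ, (((Ioi (0 : ℝ)).indicator (fun v : ℝ => Real.exp (a * v)) v : ℝ) : ℂ) * (limKernel θ (x - v) : ℂ) =
      (((∫ v in Ioi (0 : ℝ), Real.exp (a * v) * limKernel θ (x - v) : ℝ)) : ℂ) := by
  rw [← integral_complex_ofReal, ← MeasureTheory.integral_indicator measurableSet_Ioi]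
  refine integral_congr_ae (Filter.Eventually.of_forall fun v ↦ ?_)
  by_cases hv : v ∈ Ioi (0 : ℝ)
  · simp only [Set.indicator_of_mem hv, Complex.ofReal_mul]
  · simp only [Set.indicator_of_notMem hv, Complex.ofReal_zero, zero_mul]

/-- RH-FREE.  The prime-side weight as a real number: `(n : ℂ)^{−1/2} = ↑((n : ℝ)^{−1/2})`. -/
theorem natCast_cpow_neg_half (n : ℕ) : ((n : ℂ) ^ (-(1 / 2 : ℂ))) = ((((n : ℝ) ^ (-(1 / 2 : ℝ)) : ℝ)) : ℂ) := by
  rw [Complex.ofReal_cpow (Nat.cast_nonneg n)]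
  push_cast
  ring_nf

/-- **RH-FREE · the flow kernel as an explicit real kernel**: for `θ > 1` and real `x`,
`J_θ(x) = −2∫₀^∞ e^{−v/2}K_θ(x−v)dv − 2∫₀^∞ e^{v/2}K_θ(x−v)dv + (log π + γ)K_θ(x)`
`  − Σ' k (K_θ(x)/(k+1) − 2∫₀^∞ e^{−(2k+½)v}K_θ(x−v)dv) + 2Σ' n Λ(n) n^{−1/2} K_θ(x − log n)`.
Nothing here bears on RH. -/
theorem flowKernel_eq {θ : ℝ} (hθ : 1 < θ) (x : ℝ) :
    flowKernel θ x =
      -2 * (∫ v in Ioi (0 : ℝ), Real.exp (-(1 / 2) * v) * limKernel θ (x - v)) +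
      (-2) * (∫ v in Ioi (0 : ℝ), Real.exp (1 / 2 * v) * limKernel θ (x - v)) +
      (Real.log Real.pi + Real.eulerMascheroniConstant) * limKernel θ x -
      (∑' k : ℕ, (limKernel θ x / ((k : ℝ) + 1) -
        2 * ∫ v in Ioi (0 : ℝ), Real.exp ((-2 * (k : ℝ) - 1 / 2) * v) * limKernel θ (x - v))) +
      2 * ∑' n : ℕ, (Λ n : ℝ) * (n : ℝ) ^ (-(1 / 2 : ℝ)) * limKernel θ (x - Real.log n) := by
  unfold flowKernel
  rw [invFourierLine_flowSymbol_mul_limTheta_explicit hθ x]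
  simp_rw [integral_indicator_exp_mul_limKernel, natCast_cpow_neg_half]
  have hk : (∑' k : ℕ, (1 / ((k : ℂ) + 1) * (limKernel θ x : ℂ) -
      2 * (((∫ v in Ioi (0 : ℝ), Real.exp ((-2 * (k : ℝ) - 1 / 2) * v) * limKernel θ (x - v) : ℝ)) : ℂ))) =
      ((((∑' k : ℕ, (limKernel θ x / ((k : ℝ) + 1) -
        2 * ∫ v in Ioi (0 : ℝ), Real.exp ((-2 * (k : ℝ) - 1 / 2) * v) * limKernel θ (x - v))) : ℝ)) : ℂ) := by
    rw [Complex.ofReal_tsum]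
    refine tsum_congr fun k ↦ ?_
    push_cast
    ring
  have hn : (∑' n : ℕ, ((Λ n : ℝ) : ℂ) * ((((n : ℝ) ^ (-(1 / 2 : ℝ)) : ℝ)) : ℂ) * (limKernel θ (x - Real.log n) : ℂ)) =
      ((((∑' n : ℕ, (Λ n : ℝ) * (n : ℝ) ^ (-(1 / 2 : ℝ)) * limKernel θ (x - Real.log n)) : ℝ)) : ℂ) := by
    rw [Complex.ofReal_tsum]
    refine tsum_congr fun n ↦ ?_
    push_cast
    ring
  rw [hk, hn]
  simp
  ring

end Summit.RiemannHypothesis.RiemannHypothesis.Theorems.SuzukiKernelSemigroup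

end
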